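import Summits.Parity.BatemanHorn.Theorems.SoloInformedAffineSubstitution
import Summits.Parity.BatemanHorn.Theorems.SoloInformedSystemPrimeCount
import Literature.NumberTheory.Sieve.AletheiaZomleferFukshanskyGarcia2020ApplicationsArithProgProofs

/-!
# SoloInformedWTrick — Bateman–Horn in residue classes, the prime fibration, and the `W`-trick

Solo unit `solo-Parity-informed` (ideation tier, informed mode), session 148; `PLAN.md` §113, CLAIMS C303.

Three structural facts about the *scope* of the conjunct `BatemanHorn` of the summit, for an
arbitrary finite index type `ι` (`k = #ι` polynomials, `D = ∏ deg f_i`, `F = ∏ f_i`,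
`f^{(W,b)} = (f_i(WX + b))_i` as in `SoloInformedAffineSubstitution`):

1. **Bateman–Horn in arithmetic progressions** (`isEquivalent_card_modEq_of_batemanHornAsymptotic_affine`,
   `batemanHornConjecture_progression`).  If `BatemanHornAsymptotic f^{(W,b)}` holds for an admissible
   class `b (mod W)` then
   `#{n ≤ x : n ≡ b (W), all f_i(n) prime} ∼ C(f) ∏_{p ∣ W}(1 - ω_f(p)/p)⁻¹ / (D W) · x / logᵏ x`;
   in particular the Bateman–Horn conjecture contains its own version in progressions (for `f = (X)`
   this is `π(x; W, b) ∼ x/(φ(W) log x)`).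
2. **The prime fibration** (`batemanHornAsymptotic_of_forall_affine`).  For a prime `q`,
   Bateman–Horn for the `q - ω_f(q)` admissible systems `f^{(q,b)}` implies Bateman–Horn for `f`:
   the classes with `q ∣ F(b)` carry `O(1)` prime values, and the admissible ones add up because
   `(q - ω_f(q)) · (1 - ω_f(q)/q)⁻¹ / q = 1`.
3. **The `W`-trick** (`batemanHornConjecture_iff_forall_rootless`; the summit conjunct `BatemanHorn`
   of `Summits/Parity/BatemanHorn/Statement.lean` *is* `BatemanHornConjecture`).  For every finite
   set `T` of primes, `BatemanHornConjecture ⟺` Bateman–Horn for the systems with `ω_f(p) = 0` for all `p ∈ T`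
   (i.e. `F(n)` free of prime factors in `T` for *every* `n`): the primes below any fixed `w` are
   pure bookkeeping for the conjecture, by induction on `T` with the prime fibration.

The growth of the main term is `tendsto_const_mul_div_log_pow_atTop` (`SoloInformedSystemPrimeCount`);
rescaling uses `tendsto_sub_div_atTop`, `isEquivalent_mul_sub_div`, `isEquivalent_log_sub_div` of
`AletheiaZomleferFukshanskyGarcia2020ApplicationsArithProgProofs` (the case `f = (aX + b)`).
-/

namespace Summit.Parity.BatemanHorn.Theorems

open Finset Filter Polynomial Asymptotics
open scoped Topology
open Literature.NumberTheory.Sieve (polyRootCountMod polyPrimeCount IsBatemanHornSystem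
  HasBatemanHornConst batemanHornConst BatemanHornAsymptotic BatemanHornConjecture
  batemanHornConjecture_iff_fintype tendsto_sub_div_atTop isEquivalent_mul_sub_div
  isEquivalent_log_sub_div)

variable {ι : Type*} [Fintype ι]

/-! ### Two asymptotic lemmas -/

/-- **Rescaling along a progression.**  If `u(y) ∼ K y / logᵏ y` then
`u(⌊(x - b)/W⌋) ∼ (K/W) x / logᵏ x` (`W ≥ 1`). [folklore] -/
theorem isEquivalent_comp_sub_div {u : ℕ → ℝ} {K : ℝ} {k : ℕ}
    (hu : u ~[atTop] fun y : ℕ => K * (y : ℝ) / Real.log y ^ k) {W : ℕ} (hW : 0 < W) (b : ℕ) :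
    (fun x : ℕ => u ((x - b) / W)) ~[atTop] fun x : ℕ => K / W * (x : ℝ) / Real.log x ^ k := by
  have hWr : (W : ℝ) ≠ 0 := by exact_mod_cast hW.ne'
  have h1 := hu.comp_tendsto (tendsto_sub_div_atTop W b hW)
  have h3 := ((IsEquivalent.refl (u := fun _ : ℕ => K / W)).mul (isEquivalent_mul_sub_div W b hW)).div
    ((isEquivalent_log_sub_div W b hW).pow k)
  have h2 : ((fun y : ℕ => K * (y : ℝ) / Real.log y ^ k) ∘ fun x : ℕ => (x - b) / W) ~[atTop]
      fun x : ℕ => K / W * (x : ℝ) / Real.log x ^ k := by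
    refine (h3.congr_left (Eventually.of_forall fun x => ?_)).congr_right
      (Eventually.of_forall fun x => ?_)
    · simp only [Pi.div_apply, Pi.mul_apply, Pi.pow_apply, Function.comp_apply]
      rw [← mul_assoc, div_mul_cancel₀ K hWr]
    · simp only [Pi.div_apply, Pi.mul_apply, Pi.pow_apply]
  exact h1.trans h2

/-- **Adding up asymptotics.**  If `u_a - c_a g = o(g)` for every `a ∈ s` and `∑_a c_a = 1` then
`∑_a u_a ∼ g`. [folklore] -/
theorem isEquivalent_sum_of_isLittleO {α : Type*} (s : Finset α) {u : α → ℕ → ℝ} {c : α → ℝ}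
    {g : ℕ → ℝ} (h : ∀ a ∈ s, (fun x => u a x - c a * g x) =o[atTop] g) (hc : ∑ a ∈ s, c a = 1) :
    (fun x => ∑ a ∈ s, u a x) ~[atTop] g := by
  have hsum := IsLittleO.sum h
  unfold IsEquivalent
  refine hsum.congr' (Eventually.of_forall fun x => ?_) EventuallyEq.rfl
  show ∑ a ∈ s, (u a x - c a * g x) = ∑ a ∈ s, u a x - g x
  rw [sum_sub_distrib, ← sum_mul, hc, one_mul]

/-! ### Bateman–Horn in arithmetic progressions -/

/-- **Bateman–Horn in a residue class.**  Let `f` be a Bateman–Horn system, `W ≥ 1`, `b < W`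
admissible (`p ∤ F(b)` for all primes `p ∣ W`).  If `BatemanHornAsymptotic f^{(W,b)}` holds then
`#{n ≤ x : n ≡ b (mod W), f_i(n) prime ∀ i} ∼ C(f) ∏_{p ∣ W} (1 - ω_f(p)/p)⁻¹ / (D·W) · x / logᵏ x`. -/
theorem isEquivalent_card_modEq_of_batemanHornAsymptotic_affine {f : ι → ℤ[X]}
    (hf : IsBatemanHornSystem f) {W b : ℕ} (hbW : b < W)
    (hb : ∀ p : ℕ, p.Prime → p ∣ W → ¬ (p : ℤ) ∣ ∏ i, (f i).eval (b : ℤ))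
    (h : BatemanHornAsymptotic (fun i => (f i).comp (C (W : ℤ) * X + C (b : ℤ)))) :
    (fun x : ℕ => (#((range (x + 1)).filter fun n : ℕ => n % W = b ∧ ∀ i, 0 < (f i).eval (n : ℤ) ∧
        ((f i).eval (n : ℤ)).toNat.Prime) : ℝ)) ~[atTop]
      fun x : ℕ => batemanHornConst f * (∏ q ∈ W.primeFactors, (1 - (polyRootCountMod f q : ℝ) / q)⁻¹)
        / ((∏ i, ((f i).natDegree : ℝ)) * W) * (x : ℝ) / Real.log x ^ Fintype.card ι := by
  have hW : W ≠ 0 := by omega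
  obtain ⟨Cb, hCb, heq⟩ := h
  have hCb' : Cb = batemanHornConst f
      * ∏ q ∈ W.primeFactors, (1 - (polyRootCountMod f q : ℝ) / q)⁻¹ := by
    rw [← hCb.batemanHornConst_eq, batemanHornConst_affine hf hW hb]
  have heq' : (fun y : ℕ => (polyPrimeCount (fun i => (f i).comp (C (W : ℤ) * X + C (b : ℤ))) y : ℝ))
      ~[atTop] fun y : ℕ => batemanHornConst f
        * (∏ q ∈ W.primeFactors, (1 - (polyRootCountMod f q : ℝ) / q)⁻¹)
        / (∏ i, ((f i).natDegree : ℝ)) * (y : ℝ) / Real.log y ^ Fintype.card ι := by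
    refine heq.congr_right (Eventually.of_forall fun y => ?_)
    rw [prod_natDegree_affine f hW, hCb']
  have hresc := isEquivalent_comp_sub_div heq' (Nat.pos_of_ne_zero hW) b
  have hcount : (fun x : ℕ => (polyPrimeCount (fun i => (f i).comp (C (W : ℤ) * X + C (b : ℤ)))
      ((x - b) / W) : ℝ)) =ᶠ[atTop] fun x : ℕ => (#((range (x + 1)).filter fun n : ℕ => n % W = b ∧
        ∀ i, 0 < (f i).eval (n : ℤ) ∧ ((f i).eval (n : ℤ)).toNat.Prime) : ℝ) := by
    filter_upwards [eventually_ge_atTop b] with x hx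
    rw [card_filter_modEq_eq_polyPrimeCount_affine f hW hbW hx]
  have htarget : (fun x : ℕ => batemanHornConst f
        * (∏ q ∈ W.primeFactors, (1 - (polyRootCountMod f q : ℝ) / q)⁻¹)
        / (∏ i, ((f i).natDegree : ℝ)) / W * (x : ℝ) / Real.log x ^ Fintype.card ι) =ᶠ[atTop]
      fun x : ℕ => batemanHornConst f
        * (∏ q ∈ W.primeFactors, (1 - (polyRootCountMod f q : ℝ) / q)⁻¹)
        / ((∏ i, ((f i).natDegree : ℝ)) * W) * (x : ℝ) / Real.log x ^ Fintype.card ι :=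
    Eventually.of_forall fun x => by rw [div_div]
  exact (hresc.congr_left hcount).congr_right htarget

/-- **The Bateman–Horn conjecture implies Bateman–Horn in arithmetic progressions:** under
`BatemanHornConjecture`, for every Bateman–Horn system `f`, every `W ≥ 1` and every admissible
`b < W`, `#{n ≤ x : n ≡ b (W), f_i(n) prime ∀ i} ∼ C(f) ∏_{p ∣ W}(1 - ω_f(p)/p)⁻¹/(D W) · x/logᵏ x`
(for `f = (X)`: the prime number theorem in arithmetic progressions, `1/φ(W) · x/log x`). -/
theorem batemanHornConjecture_progression (hBH : BatemanHornConjecture) {f : ι → ℤ[X]}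
    (hf : IsBatemanHornSystem f) {W b : ℕ} (hbW : b < W)
    (hb : ∀ p : ℕ, p.Prime → p ∣ W → ¬ (p : ℤ) ∣ ∏ i, (f i).eval (b : ℤ)) :
    (fun x : ℕ => (#((range (x + 1)).filter fun n : ℕ => n % W = b ∧ ∀ i, 0 < (f i).eval (n : ℤ) ∧
        ((f i).eval (n : ℤ)).toNat.Prime) : ℝ)) ~[atTop]
      fun x : ℕ => batemanHornConst f * (∏ q ∈ W.primeFactors, (1 - (polyRootCountMod f q : ℝ) / q)⁻¹)
        / ((∏ i, ((f i).natDegree : ℝ)) * W) * (x : ℝ) / Real.log x ^ Fintype.card ι :=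
  isEquivalent_card_modEq_of_batemanHornAsymptotic_affine hf hbW hb
    (batemanHornConjecture_iff_fintype.mp hBH ι _ (isBatemanHornSystem_affine hf (by omega) hb))

/-! ### The prime fibration -/

/-- **The prime fibration.**  Let `f` be a Bateman–Horn system and `q` a prime.  If
`BatemanHornAsymptotic f^{(q,b)}` holds for every admissible `b < q` (`q ∤ F(b)`), then
`BatemanHornAsymptotic f` holds: `π_f(x) = ∑_{b < q} π_{f^{(q,b)}}(⌊(x-b)/q⌋)`, the `ω_f(q)`
non-admissible classes carry at most `∑ deg f_i` prime values each, and the `q - ω_f(q)` admissible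
ones each contribute `C(f)(1 - ω_f(q)/q)⁻¹/(D q) · x/logᵏ x`, which adds up to `C(f)/D · x/logᵏ x`. -/
theorem batemanHornAsymptotic_of_forall_affine {f : ι → ℤ[X]} (hf : IsBatemanHornSystem f) {q : ℕ}
    (hq : q.Prime) (h : ∀ b : ℕ, b < q → ¬ (q : ℤ) ∣ ∏ i, (f i).eval (b : ℤ) →
      BatemanHornAsymptotic (fun i => (f i).comp (C (q : ℤ) * X + C (b : ℤ)))) :
    BatemanHornAsymptotic f := by
  classical
  obtain ⟨hC, hC₀pos⟩ := IsBatemanHornSystem.hasBatemanHornConst_holds hf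
  refine ⟨batemanHornConst f, hC, ?_⟩
  set C₀ := batemanHornConst f with hC₀
  set D : ℝ := ∏ i, ((f i).natDegree : ℝ) with hD
  set G : ℕ → ℝ := fun x => C₀ / D * (x : ℝ) / Real.log x ^ Fintype.card ι with hG
  have hDpos : 0 < D := prod_pos fun i _ => Nat.cast_pos.mpr (hf.natDegree_pos i)
  have hG_top : Tendsto G atTop atTop := tendsto_const_mul_div_log_pow_atTop (div_pos hC₀pos hDpos) _
  have hq0 : q ≠ 0 := hq.ne_zero
  have hqr : (0 : ℝ) < q := by exact_mod_cast hq.pos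
  set ω := polyRootCountMod f q with hω
  have hωq : ω < q := hf.hasNoFixedPrimeDivisor q hq
  set κ : ℝ := (1 - (ω : ℝ) / q)⁻¹ with hκ
  -- the coefficient of the class `b`
  set c : ℕ → ℝ := fun b => if ¬ (q : ℤ) ∣ ∏ i, (f i).eval (b : ℤ) then κ / q else 0 with hc
  -- class by class
  have hclass : ∀ b ∈ range q, (fun x : ℕ =>
      (polyPrimeCount (fun i => (f i).comp (C (q : ℤ) * X + C (b : ℤ))) ((x - b) / q) : ℝ)
        - c b * G x) =o[atTop] G := by
    intro b hb
    rw [mem_range] at hb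
    by_cases hadm : ¬ (q : ℤ) ∣ ∏ i, (f i).eval (b : ℤ)
    · -- an admissible class
      have hcb : c b = κ / q := if_pos hadm
      have hadm' : ∀ p : ℕ, p.Prime → p ∣ q → ¬ (p : ℤ) ∣ ∏ i, (f i).eval (b : ℤ) := by
        intro p hp hpq
        rwa [(Nat.prime_dvd_prime_iff_eq hp hq).mp hpq]
      obtain ⟨Cb, hCb, heq⟩ := h b hb hadm
      have hCb' : Cb = C₀ * κ := by
        rw [← hCb.batemanHornConst_eq, batemanHornConst_affine hf hq0 hadm', Nat.Prime.primeFactors hq,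
          prod_singleton]
      have heq' : (fun y : ℕ =>
          (polyPrimeCount (fun i => (f i).comp (C (q : ℤ) * X + C (b : ℤ))) y : ℝ)) ~[atTop]
          fun y : ℕ => C₀ * κ / D * (y : ℝ) / Real.log y ^ Fintype.card ι := by
        refine heq.congr_right (Eventually.of_forall fun y => ?_)
        rw [prod_natDegree_affine f hq0, hCb']
      have hresc := isEquivalent_comp_sub_div heq' hq.pos b
      have hresc' : (fun x : ℕ =>
          (polyPrimeCount (fun i => (f i).comp (C (q : ℤ) * X + C (b : ℤ))) ((x - b) / q) : ℝ))
            ~[atTop] fun x => c b * G x := by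
        refine hresc.congr_right (Eventually.of_forall fun x => ?_)
        simp only [hcb, hG]
        ring
      exact hresc'.isLittleO.trans_isBigO (isBigO_const_mul_self (c b) G atTop)
    · -- a non-admissible class: bounded
      have hcb : c b = 0 := if_neg hadm
      rw [not_not] at hadm
      simp only [hcb, zero_mul, sub_zero]
      refine IsBigO.trans_isLittleO (g := fun _ : ℕ => (1 : ℝ)) ?_
        ((isLittleO_one_left_iff ℝ).2 (tendsto_norm_atTop_atTop.comp hG_top))
      refine IsBigO.of_bound (∑ i, ((f i).natDegree : ℝ)) (Eventually.of_forall fun x => ?_)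
      rw [norm_one, mul_one, Real.norm_eq_abs, abs_of_nonneg (Nat.cast_nonneg _)]
      exact_mod_cast polyPrimeCount_affine_le_of_dvd hf hq0 hq dvd_rfl hadm _
  -- the coefficients add up to one
  have hA : #((range q).filter fun b : ℕ => ¬ (q : ℤ) ∣ ∏ i, (f i).eval (b : ℤ)) = q - ω := by
    rw [filter_not, card_sdiff_of_subset (filter_subset _ _), card_range]
    rfl
  have hsumc : ∑ b ∈ range q, c b = 1 := by
    simp only [hc]
    rw [sum_ite, sum_const_zero, add_zero, sum_const, hA, nsmul_eq_mul, Nat.cast_sub hωq.le]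
    have hne : (q : ℝ) - ω ≠ 0 := sub_ne_zero.mpr (by exact_mod_cast hωq.ne')
    rw [hκ, show (1 : ℝ) - (ω : ℝ) / q = ((q : ℝ) - ω) / q by field_simp, inv_div]
    field_simp
  -- assemble
  have hPf : ∀ᶠ x : ℕ in atTop, (∑ b ∈ range q,
      (polyPrimeCount (fun i => (f i).comp (C (q : ℤ) * X + C (b : ℤ))) ((x - b) / q) : ℝ))
        = (polyPrimeCount f x : ℝ) := by
    filter_upwards [eventually_ge_atTop q] with x hx
    exact_mod_cast (polyPrimeCount_eq_sum_affine f hq0 (by omega : q ≤ x + 1)).symm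
  exact (isEquivalent_sum_of_isLittleO (range q) hclass hsumc).congr_left hPf

/-! ### The `W`-trick -/

/-- One step of the `W`-trick: if Bateman–Horn holds for all systems rootless at the primes of
`insert q T`, it holds for all systems rootless at the primes of `T` (fibre over the classes mod `q`;
an admissible `f^{(q,b)}` is rootless at `q` and keeps `ω = 0` at the other primes). -/
theorem batemanHorn_rootless_step {T : Finset ℕ} (hT : ∀ p ∈ T, p.Prime) {q : ℕ} (hq : q.Prime)
    (h : ∀ (k : ℕ) (f : Fin k → ℤ[X]), IsBatemanHornSystem f →
      (∀ p ∈ insert q T, polyRootCountMod f p = 0) → BatemanHornAsymptotic f)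
    (k : ℕ) (f : Fin k → ℤ[X]) (hf : IsBatemanHornSystem f) (hfT : ∀ p ∈ T, polyRootCountMod f p = 0) :
    BatemanHornAsymptotic f := by
  refine batemanHornAsymptotic_of_forall_affine hf hq fun b hb hadm => ?_
  have hadm' : ∀ p : ℕ, p.Prime → p ∣ q → ¬ (p : ℤ) ∣ ∏ i, (f i).eval (b : ℤ) := by
    intro p hp hpq
    rwa [(Nat.prime_dvd_prime_iff_eq hp hq).mp hpq]
  refine h k _ (isBatemanHornSystem_affine hf hq.ne_zero hadm') fun p hp => ?_
  by_cases hpq : p = q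
  · subst hpq
    exact polyRootCountMod_affine_of_dvd f dvd_rfl hadm
  · have hpT : p ∈ T := (mem_insert.mp hp).resolve_left hpq
    rw [polyRootCountMod_affine_of_not_dvd f _ (hT p hpT)
      (fun hd => hpq ((Nat.prime_dvd_prime_iff_eq (hT p hpT) hq).mp hd))]
    exact hfT p hpT

/-- **Bateman–Horn for rootless systems suffices.**  If, for a finite set `T` of primes, the
Bateman–Horn asymptotic holds for every Bateman–Horn system with `ω_f(p) = 0` for all `p ∈ T`, then
the Bateman–Horn conjecture holds (induction on `T` with the prime fibration). -/
theorem batemanHornConjecture_of_forall_rootless (T : Finset ℕ) (hT : ∀ p ∈ T, p.Prime)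
    (h : ∀ (k : ℕ) (f : Fin k → ℤ[X]), IsBatemanHornSystem f →
      (∀ p ∈ T, polyRootCountMod f p = 0) → BatemanHornAsymptotic f) :
    BatemanHornConjecture := by
  induction T using Finset.induction_on with
  | empty => exact fun k f hf => h k f hf (by simp)
  | insert q T hqT ih =>
    exact ih (fun p hp => hT p (mem_insert_of_mem hp))
      (batemanHorn_rootless_step (fun p hp => hT p (mem_insert_of_mem hp))
        (hT q (mem_insert_self q T)) h)

/-- **The `W`-trick for the Bateman–Horn conjecture.**  For every finite set `T` of primes:
`BatemanHornConjecture ⟺` the Bateman–Horn asymptotic for the systems `f` with no root of `∏ f_i`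
modulo any `p ∈ T` (equivalently: `p ∤ ∏ f_i(n)` for every `n` and every `p ∈ T`).  The small
primes are bookkeeping: they can be removed from every instance of the conjecture by passing to the
admissible progressions modulo `W = ∏_{p ∈ T} p`. -/
theorem batemanHornConjecture_iff_forall_rootless (T : Finset ℕ) (hT : ∀ p ∈ T, p.Prime) :
    BatemanHornConjecture ↔ ∀ (k : ℕ) (f : Fin k → ℤ[X]), IsBatemanHornSystem f →
      (∀ p ∈ T, polyRootCountMod f p = 0) → BatemanHornAsymptotic f :=
  ⟨fun hBH k f hf _ => hBH k f hf, batemanHornConjecture_of_forall_rootless T hT⟩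

/-- **The `W`-trick below a threshold.**  For every `w`: `BatemanHornConjecture ⟺` the
Bateman–Horn asymptotic for the systems with `ω_f(p) = 0` for every prime `p ≤ w`. -/
theorem batemanHornConjecture_iff_forall_rootless_le (w : ℕ) :
    BatemanHornConjecture ↔ ∀ (k : ℕ) (f : Fin k → ℤ[X]), IsBatemanHornSystem f →
      (∀ p : ℕ, p.Prime → p ≤ w → polyRootCountMod f p = 0) → BatemanHornAsymptotic f := by
  rw [batemanHornConjecture_iff_forall_rootless ((range (w + 1)).filter Nat.Prime)
    (fun p hp => (mem_filter.mp hp).2)]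
  refine forall₃_congr fun k f hf => ⟨fun h hw => h fun p hp => ?_, fun h hT => h fun p hp hpw => ?_⟩
  · exact hw p (mem_filter.mp hp).2 (Nat.lt_succ_iff.mp (mem_range.mp (mem_filter.mp hp).1))
  · exact hT p (mem_filter.mpr ⟨mem_range.mpr (Nat.lt_succ_of_le hpw), hp⟩)

end Summit.Parity.BatemanHorn.Theorems
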